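import Summits.QuantumFields.YangMills.Theorems.BalabanUVNodesN27KeyedCore
import Summits.QuantumFields.YangMills.Theorems.BalabanUVNodesN27BudgetRedundant
import Summits.QuantumFields.YangMills.Theorems.BalabanUVNodesRateCarriersOfRecord13CoPH
import Summits.QuantumFields.YangMills.Theorems.BalabanUVNodesSpineRatesHolder

/-!
# BalabanUVNodes ∕ N19 — THE `ForSmallCouplings`-GUARDED COMPOSER: B5 (`HybridNE7Under`) at a keyed datum asks the N19′ ∕ N20 ∕ N21 faces ONLY UNDER THE PREFIX,
# so an FSC-guarded N19′ face (this seat's `…N19RateEdgeHolderD4AtRuns`) composes with leaf D's other faces exactly as the ∀-`g₀` face does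

Cell `pub-ymgap`, HUMAN RULING D-0062 (Track A) + D-0149 (work-bound push, director-ym №197), WIDTH SEAT `pub-ymgap-dag-n19-w3` (N19 NE7, seat 3 of 3),
generation g2; bus CLAIM∕INTENT-3 (pub-ymgap INBOX l.26332; dag-n19-d g24 l.26168 withdrew the -d lane's composer offer l.25428 ∕ l.25666 «as a duplicate of your pen»).
Route `Summits/QuantumFields/YangMills/Theses/BalabanUVNodes.lean` rev 25, cluster item K3⁷ «SpineGivenEndpointR13SepCoPH» (stmt-QuantumFields-20544), plan g79's skeleton v2
145a664ea9c38a7b (concluder = dag-n27-c's leaf D `spineGivenEndpointR13SepCoPH_of_keyedFacesP`, whose N19′ slot `h19` is asked at EVERY `g₀`); filed `--kind proof --supports`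
that item `--as helper` (it proves no registered stub).  COUNT-NEUTRAL.  THEOREMS ONLY; 0 `def`; 0 `sorry`; `N`-generic, key-generic (§1, the shape of dag-n27-c's
`…N27KeyedCore` §1), guard-generic `G`, rates-predicate-generic `P`; NO Theses import.  Imports dag-n27-c's `…N27KeyedCore` (the abstract key's vocabulary), dag-n27-a's
`…N27BudgetRedundant` (`hybridNE7Under_of_spineNodes_tail` ∕ `hybridNE7Under_iff_spineNodes_tail`: B5 IS the per-string package under the prefix) and dag-n22-e's
`…RateCarriersOfRecord13CoPH` (the Stage-13 `CoPH` key) and dag-n16-e's `…SpineRatesHolder` (`RatesHolderAt`, §3) — CITED BY NAME, none edited; leaf D and XXIVc (`…N27AtRecord13CoPHKeyedCore.keyedGuarded₁₃CoPH_of_keyedFacesP`) are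
the ∀-`g₀` siblings, not imported; this seat's `…N19RateEdgeHolderD4AtRuns` (p593217) is the intended `h19` supplier, plugged where its link reading is in scope (`…D4AtRunsV`).

THE POINT (dag-n19-d's LOCATED DESIGN NOTE l.25428, plan's (t9); numbers, not adjectives).  `T4ApexHybrid.HybridNE7Under D Hβ` is `(B) → Hβ → ForSmallCouplings D (fun g₀ =>
StringwiseHybridNE7 (D.scheme g₀))` DEFINITIONALLY (`T4ContinuumYM4Torus.underHypotheses_iff`), and dag-n27-a's `hybridNE7Under_iff_spineNodes_tail` shows it EQUIVALENT to the
per-string package «`0 < l₀ ∧ 0 < vol ∧ RelWeightBound ∧ ShellWeightBound ∧ NE7.Core … δ ∧ Summable δ ∧ E1 ∧ E2` at SOME carriers» UNDER THE SAME PREFIX.  Hence a composer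
that asks the N19′ core face (and the rates it reads, and even N20 ∕ N21) only under `ForSmallCouplings (datumOf θ hP)` loses NOTHING: §1 below concludes the same
`HybridNE7Under (datumOf θ hP) (EndpointExistence …)` as `…N27KeyedCore.forall_keyed_of_keyedCore`, from hypotheses each IMPLIED by the ∀-`g₀` ones
(`ForSmallCouplings.of_forall`).  This is the consumer this seat's INTENT-1 face `N19RateEdgeHolderD4AtRuns.forSmallCouplings_keyedCoreEdgeHolderD4_of_linkReadingAtRuns` (the
(v′-17) run block of the link reading discharged, available ONLY under the prefix) was missing: `h19 := that face` (given K1⁷'s β-window at the tuple) is ONE application of §2.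

WHAT THIS FILE PROVES.
* §1 (abstract key `Θ ∕ Hp ∕ Adm ∕ datumOf ∕ cr ∕ rr`, any rates predicate `P`) `forall_keyed_hybridNE7Under_of_fscCore` — N20 ∕ N21 at `cr θ hP g₀ os` for every `g₀`
  (leaf D's shapes), the ∃δ-core face and the extraction clause BOTH under `(B) → EndpointExistence → ForSmallCouplings (datumOf θ hP)` ⇒ `∀ θ hP, Adm θ → HybridNE7Under
  (datumOf θ hP) (EndpointExistence (datumOf θ hP).C.toB12)` (`ForSmallCouplings.and` + `.mono` into dag-n27-a's package, carriers `:= cr θ hP g₀ os` field by field);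
  `forall_keyed_hybridNE7Under_of_fscFacesP` — the same with the core face SPLIT as «rates `P` under the prefix» + «`P →` core under the prefix» (v2's `hrates`∕`h19` cut,
  both FSC-guarded); `…_of_fscCoreP_forallRates` — rates at every `g₀` (v2's `KeyedRatesHolderD4` shape) and only the N19′ face under the prefix.
* §2 (the Stage-13 `CoPH` key, guard `G`, `N`-generic) `keyedGuarded₁₃CoPH_of_keyedFacesP_fsc` — XXIVc's `keyedGuarded₁₃CoPH_of_keyedFacesP` with `hrates` and `h19` asked
  ONLY under `ForSmallCouplings (datumOfRecord₁₃CoPH F N θ hP)`; `…_forallRates` — with v2's ∀-`g₀` rates.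
* §3 (the β-window plug, `P := PHolderD4 β` spelled out, `rr := rateCarriersOfRecord₁₃CoPH 𝔯 … (ks …)`) `keyedGuarded₁₃CoPH_of_fscCoreEdgeHolderD4_betaWindow` — from N20 ∕ N21
  at `cr`, v2's ∀-`g₀` rates, leaf D's extraction clause, an N19′ face under the prefix GIVEN K1⁷'s interval-form β-window (the exact conclusion shape of this seat's
  `forSmallCouplings_keyedCoreEdgeHolderD4_of_linkReadingAtRuns`) and that window at every guarded admissible tuple ⇒ `HybridNE7Under (datumOfRecord₁₃CoPH F N θ hP)
  (EndpointExistence …)` at every guarded admissible tuple — at `N = 2`, `G :=` the item guard this is K3⁷'s conclusion (leaf D drops the item's two displayed antecedents the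
  same way), MODULO the N19′ face's own residual (`hlink`), NODE O's three other faces and K1⁷'s window; `…_betaWindowPos` — the twin with `0 < b` threaded (the
  shape of this seat's AtRunsAlong face, which reads BOTH halves of the window).
So: the N19′ slot CAN be typed under the prefix in a v3 without touching leaf D's conclusion — a kernel fact for plan's (t9) word, nothing proposed here.

HONEST FRAMING.  Count-neutral COMPOSITE-node bookkeeping over hypothesis SHAPES (two `ForSmallCouplings.and`∕`.mono` steps + dag-n27-a's package); every face is a
HYPOTHESIS (0∕1 inhabited at every record today: `hlink` is NODE O's world, `hx` NODE O's extraction, `h20`∕`h21` N20∕N21's, the rates K4's, the β-window K1⁷'s); nothing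
of Bałaban's asserted or instantiated (K0⁷ OPEN); NE7 ∕ NE7b ∕ NE7c NOT PRINTED for d = 4 and NOT proved; N19 NOT discharged; K3⁷ NOT claimed; no skeleton text touched, no v3
proposed; Track A count unmoved (typed 28∕28 · discharged 5∕27 · A 5∕28).  One finite four-torus at fixed ε, rung (B)+1 — R4 closes the CONDITIONAL finite-𝕋⁴ rung
`BalabanLadder.UV` only; NOT infinite volume, NOT OS on ℝ⁴, NOT a mass gap; the YM mass gap (Clay) is NOT proved by any of this.  Standard axioms.  Supersedes nothing; edits
nothing.  No decl below carries a cite tag.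
-/

set_option autoImplicit false

noncomputable section

namespace Summit.QuantumFields.YangMills.BalabanUVNodes.N19CoreEdgeFSCComposer

open Literature.MathematicalPhysics.QuantumFieldTheory.Balaban1983to89
open Literature.MathematicalPhysics.QuantumFieldTheory.Balaban1983to89.T4Continuum
open T4WeightBudget (RelWeightBound)
open T4IndicatorShell (ShellWeightBound)
open T4ContinuumYM4Torus (ForSmallCouplings)
open T4ApexHybrid (HybridNE7Under)
open Summit.QuantumFields.BalabanUV.T4Continuum.Spine
open YMDAG.UVSplit
open Node00 (Stage13HParams datumOfRecord₁₃CoPH)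
open Summit.QuantumFields.YangMills.BalabanUVNodes.SpineRatesHolder (RatesHolderAt)
open Summit.QuantumFields.YangMills.Theorems.BalabanUVNodesN27SpineRecord (hybridNE7Under_of_spineNodes_tail)

universe u

variable {N : ℕ} [NeZero N]

/-! ## §1 Abstract key: B5 at a keyed datum from N20 ∕ N21 and the FSC-GUARDED core ∕ extraction faces -/

section Abstract

variable {Θ : T4Family → Type u} (Hp : ∀ {F : T4Family}, Θ F → Prop) (Adm : ∀ {F : T4Family}, Θ F → Prop)
  (datumOf : ∀ {F : T4Family} (θ : Θ F), Hp θ → Datum F N)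
  (cr : ∀ {F : T4Family} (θ : Θ F), Hp θ → (ℕ → ℝ) → List (ULoop F) → SpineCarriers)
  (rr : ∀ {F : T4Family} (θ : Θ F), Hp θ → (ℕ → ℝ) → List (ULoop F) → RateCarriers N)

/-- **B5 AT A KEYED DATUM FROM N20, N21 AND THE `ForSmallCouplings`-GUARDED CORE AND EXTRACTION FACES** [bookkeeping]: `…N27KeyedCore.forall_keyed_of_keyedCore` with its
UNCONDITIONAL ∃δ-core face `hcore` weakened to «under `(B) → EndpointExistence → ForSmallCouplings (datumOf θ hP)`» — the prefix B5 itself lives under (dag-n27-a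
`hybridNE7Under_of_spineNodes_tail`; carriers `:= cr θ hP g₀ os` field by field). -/
theorem forall_keyed_hybridNE7Under_of_fscCore
    (h20 : ∀ (F : T4Family) (θ : Θ F) (hP : Hp θ), Adm θ → ∀ (g₀ : ℕ → ℝ) (os : List (ULoop F)),
      RelWeightBound (cr θ hP g₀ os).l₀ (cr θ hP g₀ os).T (cr θ hP g₀ os).A (cr θ hP g₀ os).B (cr θ hP g₀ os).Bad (cr θ hP g₀ os).W)
    (h21 : ∀ (F : T4Family) (θ : Θ F) (hP : Hp θ), Adm θ → ∀ (g₀ : ℕ → ℝ) (os : List (ULoop F)),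
      ShellWeightBound (cr θ hP g₀ os).l₀ (cr θ hP g₀ os).T (cr θ hP g₀ os).A (cr θ hP g₀ os).B (cr θ hP g₀ os).shA (cr θ hP g₀ os).shB (cr θ hP g₀ os).Wsh)
    (hcore : ∀ (F : T4Family) (θ : Θ F) (hP : Hp θ), Adm θ →
      B16.EndStatementBPrinted (datumOf θ hP).C → DagBinding.EndpointExistence (datumOf θ hP).C.toB12 →
        ForSmallCouplings (datumOf θ hP) fun g₀ => ∀ os : List (ULoop F), letI := (cr θ hP g₀ os).dec
          ∃ δ : ℕ → ℝ, NE7.Core (cr θ hP g₀ os).l₀ (cr θ hP g₀ os).vol (cr θ hP g₀ os).T (cr θ hP g₀ os).Bad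
            (fun K t τ => (cr θ hP g₀ os).A K t τ - (cr θ hP g₀ os).shA K t τ) (fun K t τ => (cr θ hP g₀ os).B K t τ - (cr θ hP g₀ os).shB K t τ) δ ∧ Summable δ)
    (hx : ∀ (F : T4Family) (θ : Θ F) (hP : Hp θ), Adm θ →
      B16.EndStatementBPrinted (datumOf θ hP).C → DagBinding.EndpointExistence (datumOf θ hP).C.toB12 →
        ForSmallCouplings (datumOf θ hP) fun g₀ => ∀ os : List (ULoop F),
          0 < (cr θ hP g₀ os).l₀ ∧ 0 < (cr θ hP g₀ os).vol ∧
          (∀ (K : ℕ) (t : ℝ), |t| ≤ (cr θ hP g₀ os).l₀ →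
            T4GenFunBounds.schemeZ ((datumOf θ hP).scheme g₀) os ((cr θ hP g₀ os).K₀ + K) t = ∑ τ ∈ (cr θ hP g₀ os).T K, (cr θ hP g₀ os).A K t τ) ∧
          (∀ (K : ℕ) (t : ℝ), |t| ≤ (cr θ hP g₀ os).l₀ →
            T4GenFunBounds.schemeZ ((datumOf θ hP).scheme g₀) os ((cr θ hP g₀ os).K₀ + K + 1) t = ∑ τ ∈ (cr θ hP g₀ os).T K, (cr θ hP g₀ os).B K t τ))
    (F : T4Family) (θ : Θ F) (hP : Hp θ) (hθ : Adm θ) :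
    HybridNE7Under (datumOf θ hP) (DagBinding.EndpointExistence (datumOf θ hP).C.toB12) := by
  refine hybridNE7Under_of_spineNodes_tail (datumOf θ hP) ?_
  intro hB hEnd
  refine ((hcore F θ hP hθ hB hEnd).and (hx F θ hP hθ hB hEnd)).mono fun g₀ hg os => ?_
  obtain ⟨δ, hc, hδ⟩ := hg.1 os
  obtain ⟨hl₀, hvol, hZA, hZB⟩ := hg.2 os
  exact ⟨(cr θ hP g₀ os).ι, (cr θ hP g₀ os).dec, (cr θ hP g₀ os).l₀, (cr θ hP g₀ os).vol, (cr θ hP g₀ os).K₀, (cr θ hP g₀ os).T, (cr θ hP g₀ os).A,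
    (cr θ hP g₀ os).B, (cr θ hP g₀ os).shA, (cr θ hP g₀ os).shB, (cr θ hP g₀ os).Bad, (cr θ hP g₀ os).W, (cr θ hP g₀ os).Wsh, δ, hl₀, hvol,
    h20 F θ hP hθ g₀ os, h21 F θ hP hθ g₀ os, hc, hδ, hZA, hZB⟩

variable (P : ∀ {F : T4Family}, Datum F N → RateCarriers N → Prop)

/-- **… WITH THE CORE FACE CUT AS «RATES UNDER THE PREFIX» + «RATES ⇒ CORE UNDER THE PREFIX»** (v2's `hrates` ∕ `h19` split, both `ForSmallCouplings`-guarded; an ∀-`g₀`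
face is an FSC face by `ForSmallCouplings.of_forall`). [bookkeeping] -/
theorem forall_keyed_hybridNE7Under_of_fscFacesP
    (h20 : ∀ (F : T4Family) (θ : Θ F) (hP : Hp θ), Adm θ → ∀ (g₀ : ℕ → ℝ) (os : List (ULoop F)),
      RelWeightBound (cr θ hP g₀ os).l₀ (cr θ hP g₀ os).T (cr θ hP g₀ os).A (cr θ hP g₀ os).B (cr θ hP g₀ os).Bad (cr θ hP g₀ os).W)
    (h21 : ∀ (F : T4Family) (θ : Θ F) (hP : Hp θ), Adm θ → ∀ (g₀ : ℕ → ℝ) (os : List (ULoop F)),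
      ShellWeightBound (cr θ hP g₀ os).l₀ (cr θ hP g₀ os).T (cr θ hP g₀ os).A (cr θ hP g₀ os).B (cr θ hP g₀ os).shA (cr θ hP g₀ os).shB (cr θ hP g₀ os).Wsh)
    (hrates : ∀ (F : T4Family) (θ : Θ F) (hP : Hp θ), Adm θ →
      B16.EndStatementBPrinted (datumOf θ hP).C → DagBinding.EndpointExistence (datumOf θ hP).C.toB12 →
        ForSmallCouplings (datumOf θ hP) fun g₀ => ∀ os : List (ULoop F), P (datumOf θ hP) (rr θ hP g₀ os))
    (h19 : ∀ (F : T4Family) (θ : Θ F) (hP : Hp θ), Adm θ →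
      B16.EndStatementBPrinted (datumOf θ hP).C → DagBinding.EndpointExistence (datumOf θ hP).C.toB12 →
        ForSmallCouplings (datumOf θ hP) fun g₀ => ∀ os : List (ULoop F), P (datumOf θ hP) (rr θ hP g₀ os) → letI := (cr θ hP g₀ os).dec
          ∃ δ : ℕ → ℝ, NE7.Core (cr θ hP g₀ os).l₀ (cr θ hP g₀ os).vol (cr θ hP g₀ os).T (cr θ hP g₀ os).Bad
            (fun K t τ => (cr θ hP g₀ os).A K t τ - (cr θ hP g₀ os).shA K t τ) (fun K t τ => (cr θ hP g₀ os).B K t τ - (cr θ hP g₀ os).shB K t τ) δ ∧ Summable δ)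
    (hx : ∀ (F : T4Family) (θ : Θ F) (hP : Hp θ), Adm θ →
      B16.EndStatementBPrinted (datumOf θ hP).C → DagBinding.EndpointExistence (datumOf θ hP).C.toB12 →
        ForSmallCouplings (datumOf θ hP) fun g₀ => ∀ os : List (ULoop F),
          0 < (cr θ hP g₀ os).l₀ ∧ 0 < (cr θ hP g₀ os).vol ∧
          (∀ (K : ℕ) (t : ℝ), |t| ≤ (cr θ hP g₀ os).l₀ →
            T4GenFunBounds.schemeZ ((datumOf θ hP).scheme g₀) os ((cr θ hP g₀ os).K₀ + K) t = ∑ τ ∈ (cr θ hP g₀ os).T K, (cr θ hP g₀ os).A K t τ) ∧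
          (∀ (K : ℕ) (t : ℝ), |t| ≤ (cr θ hP g₀ os).l₀ →
            T4GenFunBounds.schemeZ ((datumOf θ hP).scheme g₀) os ((cr θ hP g₀ os).K₀ + K + 1) t = ∑ τ ∈ (cr θ hP g₀ os).T K, (cr θ hP g₀ os).B K t τ))
    (F : T4Family) (θ : Θ F) (hP : Hp θ) (hθ : Adm θ) :
    HybridNE7Under (datumOf θ hP) (DagBinding.EndpointExistence (datumOf θ hP).C.toB12) :=
  forall_keyed_hybridNE7Under_of_fscCore Hp Adm datumOf cr h20 h21
    (fun F θ hP hθ hB hEnd => ((hrates F θ hP hθ hB hEnd).and (h19 F θ hP hθ hB hEnd)).mono fun _ hg os => hg.2 os (hg.1 os)) hx F θ hP hθ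

/-- **… WITH v2's ∀-`g₀` RATES AND ONLY THE N19′ FACE UNDER THE PREFIX** (the rates face as in `KeyedRatesHolderD4`; `ForSmallCouplings.of_forall`). [bookkeeping] -/
theorem forall_keyed_hybridNE7Under_of_fscCoreP_forallRates
    (h20 : ∀ (F : T4Family) (θ : Θ F) (hP : Hp θ), Adm θ → ∀ (g₀ : ℕ → ℝ) (os : List (ULoop F)),
      RelWeightBound (cr θ hP g₀ os).l₀ (cr θ hP g₀ os).T (cr θ hP g₀ os).A (cr θ hP g₀ os).B (cr θ hP g₀ os).Bad (cr θ hP g₀ os).W)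
    (h21 : ∀ (F : T4Family) (θ : Θ F) (hP : Hp θ), Adm θ → ∀ (g₀ : ℕ → ℝ) (os : List (ULoop F)),
      ShellWeightBound (cr θ hP g₀ os).l₀ (cr θ hP g₀ os).T (cr θ hP g₀ os).A (cr θ hP g₀ os).B (cr θ hP g₀ os).shA (cr θ hP g₀ os).shB (cr θ hP g₀ os).Wsh)
    (hrates : ∀ (F : T4Family) (θ : Θ F) (hP : Hp θ), Adm θ → ∀ (g₀ : ℕ → ℝ) (os : List (ULoop F)), P (datumOf θ hP) (rr θ hP g₀ os))
    (h19 : ∀ (F : T4Family) (θ : Θ F) (hP : Hp θ), Adm θ →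
      B16.EndStatementBPrinted (datumOf θ hP).C → DagBinding.EndpointExistence (datumOf θ hP).C.toB12 →
        ForSmallCouplings (datumOf θ hP) fun g₀ => ∀ os : List (ULoop F), P (datumOf θ hP) (rr θ hP g₀ os) → letI := (cr θ hP g₀ os).dec
          ∃ δ : ℕ → ℝ, NE7.Core (cr θ hP g₀ os).l₀ (cr θ hP g₀ os).vol (cr θ hP g₀ os).T (cr θ hP g₀ os).Bad
            (fun K t τ => (cr θ hP g₀ os).A K t τ - (cr θ hP g₀ os).shA K t τ) (fun K t τ => (cr θ hP g₀ os).B K t τ - (cr θ hP g₀ os).shB K t τ) δ ∧ Summable δ)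
    (hx : ∀ (F : T4Family) (θ : Θ F) (hP : Hp θ), Adm θ →
      B16.EndStatementBPrinted (datumOf θ hP).C → DagBinding.EndpointExistence (datumOf θ hP).C.toB12 →
        ForSmallCouplings (datumOf θ hP) fun g₀ => ∀ os : List (ULoop F),
          0 < (cr θ hP g₀ os).l₀ ∧ 0 < (cr θ hP g₀ os).vol ∧
          (∀ (K : ℕ) (t : ℝ), |t| ≤ (cr θ hP g₀ os).l₀ →
            T4GenFunBounds.schemeZ ((datumOf θ hP).scheme g₀) os ((cr θ hP g₀ os).K₀ + K) t = ∑ τ ∈ (cr θ hP g₀ os).T K, (cr θ hP g₀ os).A K t τ) ∧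
          (∀ (K : ℕ) (t : ℝ), |t| ≤ (cr θ hP g₀ os).l₀ →
            T4GenFunBounds.schemeZ ((datumOf θ hP).scheme g₀) os ((cr θ hP g₀ os).K₀ + K + 1) t = ∑ τ ∈ (cr θ hP g₀ os).T K, (cr θ hP g₀ os).B K t τ))
    (F : T4Family) (θ : Θ F) (hP : Hp θ) (hθ : Adm θ) :
    HybridNE7Under (datumOf θ hP) (DagBinding.EndpointExistence (datumOf θ hP).C.toB12) :=
  forall_keyed_hybridNE7Under_of_fscFacesP Hp Adm datumOf cr rr P h20 h21
    (fun F θ hP hθ _ _ => ForSmallCouplings.of_forall fun g₀ os => hrates F θ hP hθ g₀ os) h19 hx F θ hP hθ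

end Abstract

/-! ## §2 The Stage-13 `CoPH` key with a guard `G` (XXIVc's shape, the N19′ face and the rates under the prefix) -/

section Stage13

variable (cr : (F : T4Family) → (θ : Stage13HParams F N) → θ.Provisos₁₃CoPH F N → (ℕ → ℝ) → List (ULoop F) → SpineCarriers)
  (rr : (F : T4Family) → (θ : Stage13HParams F N) → θ.Provisos₁₃CoPH F N → (ℕ → ℝ) → List (ULoop F) → RateCarriers N)
  (G : ∀ {F : T4Family}, Stage13HParams F N → Prop) (P : ∀ {F : T4Family}, Datum F N → RateCarriers N → Prop)

/-- **THE GUARDED θ-KEYED B5 AT STAGE 13 FROM THE KEYED FACES, THE N19′ FACE AND ITS RATES ASKED ONLY UNDER THE PREFIX** [bookkeeping]: XXIVc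
`…N27AtRecord13CoPHKeyedCore.keyedGuarded₁₃CoPH_of_keyedFacesP` with `hrates` ∕ `h19` weakened to `(B) → EndpointExistence → ForSmallCouplings (datumOfRecord₁₃CoPH F N θ hP) …`.
At `N = 2`, `G := θ.ZhUnity F 2 ∧ θ.SlotsNondegenerate₁₃ F 2` the conclusion is K3⁷'s up to the item's two displayed antecedents (as leaf D). -/
theorem keyedGuarded₁₃CoPH_of_keyedFacesP_fsc
    (h20 : ∀ (F : T4Family) (θ : Stage13HParams F N) (hP : θ.Provisos₁₃CoPH F N), G θ → θ.Admissible F N → ∀ (g₀ : ℕ → ℝ) (os : List (ULoop F)),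
      RelWeightBound (cr F θ hP g₀ os).l₀ (cr F θ hP g₀ os).T (cr F θ hP g₀ os).A (cr F θ hP g₀ os).B (cr F θ hP g₀ os).Bad (cr F θ hP g₀ os).W)
    (h21 : ∀ (F : T4Family) (θ : Stage13HParams F N) (hP : θ.Provisos₁₃CoPH F N), G θ → θ.Admissible F N → ∀ (g₀ : ℕ → ℝ) (os : List (ULoop F)),
      ShellWeightBound (cr F θ hP g₀ os).l₀ (cr F θ hP g₀ os).T (cr F θ hP g₀ os).A (cr F θ hP g₀ os).B (cr F θ hP g₀ os).shA (cr F θ hP g₀ os).shB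
        (cr F θ hP g₀ os).Wsh)
    (hrates : ∀ (F : T4Family) (θ : Stage13HParams F N) (hP : θ.Provisos₁₃CoPH F N), G θ → θ.Admissible F N →
      B16.EndStatementBPrinted (datumOfRecord₁₃CoPH F N θ hP).C → DagBinding.EndpointExistence (datumOfRecord₁₃CoPH F N θ hP).C.toB12 →
        ForSmallCouplings (datumOfRecord₁₃CoPH F N θ hP) fun g₀ => ∀ os : List (ULoop F), P (datumOfRecord₁₃CoPH F N θ hP) (rr F θ hP g₀ os))
    (h19 : ∀ (F : T4Family) (θ : Stage13HParams F N) (hP : θ.Provisos₁₃CoPH F N), G θ → θ.Admissible F N →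
      B16.EndStatementBPrinted (datumOfRecord₁₃CoPH F N θ hP).C → DagBinding.EndpointExistence (datumOfRecord₁₃CoPH F N θ hP).C.toB12 →
        ForSmallCouplings (datumOfRecord₁₃CoPH F N θ hP) fun g₀ => ∀ os : List (ULoop F),
          P (datumOfRecord₁₃CoPH F N θ hP) (rr F θ hP g₀ os) → letI := (cr F θ hP g₀ os).dec
            ∃ δ : ℕ → ℝ, NE7.Core (cr F θ hP g₀ os).l₀ (cr F θ hP g₀ os).vol (cr F θ hP g₀ os).T (cr F θ hP g₀ os).Bad
              (fun K t τ => (cr F θ hP g₀ os).A K t τ - (cr F θ hP g₀ os).shA K t τ) (fun K t τ => (cr F θ hP g₀ os).B K t τ - (cr F θ hP g₀ os).shB K t τ) δ ∧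
              Summable δ)
    (hx : ∀ (F : T4Family) (θ : Stage13HParams F N) (hP : θ.Provisos₁₃CoPH F N), G θ → θ.Admissible F N →
      B16.EndStatementBPrinted (datumOfRecord₁₃CoPH F N θ hP).C → DagBinding.EndpointExistence (datumOfRecord₁₃CoPH F N θ hP).C.toB12 →
        ForSmallCouplings (datumOfRecord₁₃CoPH F N θ hP) fun g₀ => ∀ os : List (ULoop F),
          0 < (cr F θ hP g₀ os).l₀ ∧ 0 < (cr F θ hP g₀ os).vol ∧
          (∀ (K : ℕ) (t : ℝ), |t| ≤ (cr F θ hP g₀ os).l₀ →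
            T4GenFunBounds.schemeZ ((datumOfRecord₁₃CoPH F N θ hP).scheme g₀) os ((cr F θ hP g₀ os).K₀ + K) t =
              ∑ τ ∈ (cr F θ hP g₀ os).T K, (cr F θ hP g₀ os).A K t τ) ∧
          (∀ (K : ℕ) (t : ℝ), |t| ≤ (cr F θ hP g₀ os).l₀ →
            T4GenFunBounds.schemeZ ((datumOfRecord₁₃CoPH F N θ hP).scheme g₀) os ((cr F θ hP g₀ os).K₀ + K + 1) t =
              ∑ τ ∈ (cr F θ hP g₀ os).T K, (cr F θ hP g₀ os).B K t τ))
    (F : T4Family) (θ : Stage13HParams F N) (hP : θ.Provisos₁₃CoPH F N) (hG : G θ) (hθ : θ.Admissible F N) :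
    HybridNE7Under (datumOfRecord₁₃CoPH F N θ hP) (DagBinding.EndpointExistence (datumOfRecord₁₃CoPH F N θ hP).C.toB12) :=
  forall_keyed_hybridNE7Under_of_fscFacesP (Θ := fun F => Stage13HParams F N) (fun θ => θ.Provisos₁₃CoPH _ N) (fun θ => G θ ∧ θ.Admissible _ N)
    (fun θ h => datumOfRecord₁₃CoPH _ N θ h) (fun θ h => cr _ θ h) (fun θ h => rr _ θ h) P
    (fun F θ hP hA => h20 F θ hP hA.1 hA.2) (fun F θ hP hA => h21 F θ hP hA.1 hA.2) (fun F θ hP hA => hrates F θ hP hA.1 hA.2)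
    (fun F θ hP hA => h19 F θ hP hA.1 hA.2) (fun F θ hP hA => hx F θ hP hA.1 hA.2) F θ hP ⟨hG, hθ⟩

/-- **… WITH v2's ∀-`g₀` RATES** (`KeyedRatesHolderD4`'s shape at `P := PHolderD4 β`) and ONLY the N19′ face under the prefix. [bookkeeping] -/
theorem keyedGuarded₁₃CoPH_of_keyedFacesP_fsc_forallRates
    (h20 : ∀ (F : T4Family) (θ : Stage13HParams F N) (hP : θ.Provisos₁₃CoPH F N), G θ → θ.Admissible F N → ∀ (g₀ : ℕ → ℝ) (os : List (ULoop F)),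
      RelWeightBound (cr F θ hP g₀ os).l₀ (cr F θ hP g₀ os).T (cr F θ hP g₀ os).A (cr F θ hP g₀ os).B (cr F θ hP g₀ os).Bad (cr F θ hP g₀ os).W)
    (h21 : ∀ (F : T4Family) (θ : Stage13HParams F N) (hP : θ.Provisos₁₃CoPH F N), G θ → θ.Admissible F N → ∀ (g₀ : ℕ → ℝ) (os : List (ULoop F)),
      ShellWeightBound (cr F θ hP g₀ os).l₀ (cr F θ hP g₀ os).T (cr F θ hP g₀ os).A (cr F θ hP g₀ os).B (cr F θ hP g₀ os).shA (cr F θ hP g₀ os).shB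
        (cr F θ hP g₀ os).Wsh)
    (hrates : ∀ (F : T4Family) (θ : Stage13HParams F N) (hP : θ.Provisos₁₃CoPH F N), G θ → θ.Admissible F N → ∀ (g₀ : ℕ → ℝ) (os : List (ULoop F)),
      P (datumOfRecord₁₃CoPH F N θ hP) (rr F θ hP g₀ os))
    (h19 : ∀ (F : T4Family) (θ : Stage13HParams F N) (hP : θ.Provisos₁₃CoPH F N), G θ → θ.Admissible F N →
      B16.EndStatementBPrinted (datumOfRecord₁₃CoPH F N θ hP).C → DagBinding.EndpointExistence (datumOfRecord₁₃CoPH F N θ hP).C.toB12 →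
        ForSmallCouplings (datumOfRecord₁₃CoPH F N θ hP) fun g₀ => ∀ os : List (ULoop F),
          P (datumOfRecord₁₃CoPH F N θ hP) (rr F θ hP g₀ os) → letI := (cr F θ hP g₀ os).dec
            ∃ δ : ℕ → ℝ, NE7.Core (cr F θ hP g₀ os).l₀ (cr F θ hP g₀ os).vol (cr F θ hP g₀ os).T (cr F θ hP g₀ os).Bad
              (fun K t τ => (cr F θ hP g₀ os).A K t τ - (cr F θ hP g₀ os).shA K t τ) (fun K t τ => (cr F θ hP g₀ os).B K t τ - (cr F θ hP g₀ os).shB K t τ) δ ∧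
              Summable δ)
    (hx : ∀ (F : T4Family) (θ : Stage13HParams F N) (hP : θ.Provisos₁₃CoPH F N), G θ → θ.Admissible F N →
      B16.EndStatementBPrinted (datumOfRecord₁₃CoPH F N θ hP).C → DagBinding.EndpointExistence (datumOfRecord₁₃CoPH F N θ hP).C.toB12 →
        ForSmallCouplings (datumOfRecord₁₃CoPH F N θ hP) fun g₀ => ∀ os : List (ULoop F),
          0 < (cr F θ hP g₀ os).l₀ ∧ 0 < (cr F θ hP g₀ os).vol ∧
          (∀ (K : ℕ) (t : ℝ), |t| ≤ (cr F θ hP g₀ os).l₀ →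
            T4GenFunBounds.schemeZ ((datumOfRecord₁₃CoPH F N θ hP).scheme g₀) os ((cr F θ hP g₀ os).K₀ + K) t =
              ∑ τ ∈ (cr F θ hP g₀ os).T K, (cr F θ hP g₀ os).A K t τ) ∧
          (∀ (K : ℕ) (t : ℝ), |t| ≤ (cr F θ hP g₀ os).l₀ →
            T4GenFunBounds.schemeZ ((datumOfRecord₁₃CoPH F N θ hP).scheme g₀) os ((cr F θ hP g₀ os).K₀ + K + 1) t =
              ∑ τ ∈ (cr F θ hP g₀ os).T K, (cr F θ hP g₀ os).B K t τ))
    (F : T4Family) (θ : Stage13HParams F N) (hP : θ.Provisos₁₃CoPH F N) (hG : G θ) (hθ : θ.Admissible F N) :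
    HybridNE7Under (datumOfRecord₁₃CoPH F N θ hP) (DagBinding.EndpointExistence (datumOfRecord₁₃CoPH F N θ hP).C.toB12) :=
  keyedGuarded₁₃CoPH_of_keyedFacesP_fsc cr rr G P h20 h21
    (fun F θ hP hG hθ _ _ => ForSmallCouplings.of_forall fun g₀ os => hrates F θ hP hG hθ g₀ os) h19 hx F θ hP hG hθ

/-! ## §3 The β-window plug at `P := PHolderD4 β`: the N19′ face under the prefix GIVEN K1⁷'s window (this seat's AtRuns face's shape) -/

/-- **K3⁷'s CONCLUSION AT EVERY GUARDED ADMISSIBLE TUPLE FROM THE ∀-`g₀` FACES OF v2 AND AN N19′ FACE UNDER THE PREFIX GIVEN K1⁷'s β-WINDOW** [bookkeeping]: `P := PHolderD4 β`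
spelled out (`RatesHolderAt D R β ∧ ReadOutAt D R.u3 ∧ (0 ≤ R.u3.ρ ∧ R.u3.ρ < 1)`), `rr := rateCarriersOfRecord₁₃CoPH 𝔯 … (ks …)`; `h19w` is EXACTLY the conclusion shape of this
seat's `N19RateEdgeHolderD4AtRuns.forSmallCouplings_keyedCoreEdgeHolderD4_of_linkReadingAtRuns cr 𝔯 G hβ1 hlink ks` (one application supplies it, modulo that file's link reading
at the runs of record), `hβw` = K1⁷'s interval-form window at the tuple (`stub_betaWindow13PWS`'s currency `BetaBoundsInInterval`).  §2 with `h19 := h19w ∘ hβw`. -/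
theorem keyedGuarded₁₃CoPH_of_fscCoreEdgeHolderD4_betaWindow (𝔯 : RateReading₁₃CoPH N) {β : ℝ}
    (ks : (F : T4Family) → (θ : Stage13HParams F N) → θ.Provisos₁₃CoPH F N → (ℕ → ℝ) → List (ULoop F) → ℕ)
    (h20 : ∀ (F : T4Family) (θ : Stage13HParams F N) (hP : θ.Provisos₁₃CoPH F N), G θ → θ.Admissible F N → ∀ (g₀ : ℕ → ℝ) (os : List (ULoop F)),
      RelWeightBound (cr F θ hP g₀ os).l₀ (cr F θ hP g₀ os).T (cr F θ hP g₀ os).A (cr F θ hP g₀ os).B (cr F θ hP g₀ os).Bad (cr F θ hP g₀ os).W)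
    (h21 : ∀ (F : T4Family) (θ : Stage13HParams F N) (hP : θ.Provisos₁₃CoPH F N), G θ → θ.Admissible F N → ∀ (g₀ : ℕ → ℝ) (os : List (ULoop F)),
      ShellWeightBound (cr F θ hP g₀ os).l₀ (cr F θ hP g₀ os).T (cr F θ hP g₀ os).A (cr F θ hP g₀ os).B (cr F θ hP g₀ os).shA (cr F θ hP g₀ os).shB
        (cr F θ hP g₀ os).Wsh)
    (hrates : ∀ (F : T4Family) (θ : Stage13HParams F N) (hP : θ.Provisos₁₃CoPH F N), G θ → θ.Admissible F N → ∀ (g₀ : ℕ → ℝ) (os : List (ULoop F)),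
      RatesHolderAt (datumOfRecord₁₃CoPH F N θ hP) (rateCarriersOfRecord₁₃CoPH 𝔯 F θ hP g₀ os (ks F θ hP g₀ os)) β ∧
        ReadOutAt (datumOfRecord₁₃CoPH F N θ hP) (rateCarriersOfRecord₁₃CoPH 𝔯 F θ hP g₀ os (ks F θ hP g₀ os)).u3 ∧
        (0 ≤ (rateCarriersOfRecord₁₃CoPH 𝔯 F θ hP g₀ os (ks F θ hP g₀ os)).u3.ρ ∧ (rateCarriersOfRecord₁₃CoPH 𝔯 F θ hP g₀ os (ks F θ hP g₀ os)).u3.ρ < 1))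
    (h19w : ∀ (F : T4Family) (θ : Stage13HParams F N) (hP : θ.Provisos₁₃CoPH F N), G θ → θ.Admissible F N → ∀ {γ₀ b b' : ℝ}, 0 < γ₀ →
      DagBinding.BetaBoundsInInterval (datumOfRecord₁₃CoPH F N θ hP).C.toB12 γ₀ b b' →
        ForSmallCouplings (datumOfRecord₁₃CoPH F N θ hP) fun g₀ => ∀ os : List (ULoop F),
          (RatesHolderAt (datumOfRecord₁₃CoPH F N θ hP) (rateCarriersOfRecord₁₃CoPH 𝔯 F θ hP g₀ os (ks F θ hP g₀ os)) β ∧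
            ReadOutAt (datumOfRecord₁₃CoPH F N θ hP) (rateCarriersOfRecord₁₃CoPH 𝔯 F θ hP g₀ os (ks F θ hP g₀ os)).u3 ∧
            (0 ≤ (rateCarriersOfRecord₁₃CoPH 𝔯 F θ hP g₀ os (ks F θ hP g₀ os)).u3.ρ ∧
              (rateCarriersOfRecord₁₃CoPH 𝔯 F θ hP g₀ os (ks F θ hP g₀ os)).u3.ρ < 1)) →
          letI := (cr F θ hP g₀ os).dec
          ∃ δ : ℕ → ℝ, NE7.Core (cr F θ hP g₀ os).l₀ (cr F θ hP g₀ os).vol (cr F θ hP g₀ os).T (cr F θ hP g₀ os).Bad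
            (fun K t τ => (cr F θ hP g₀ os).A K t τ - (cr F θ hP g₀ os).shA K t τ) (fun K t τ => (cr F θ hP g₀ os).B K t τ - (cr F θ hP g₀ os).shB K t τ) δ ∧
            Summable δ)
    (hβw : ∀ (F : T4Family) (θ : Stage13HParams F N) (hP : θ.Provisos₁₃CoPH F N), G θ → θ.Admissible F N →
      ∃ γ₀ b b' : ℝ, 0 < γ₀ ∧ DagBinding.BetaBoundsInInterval (datumOfRecord₁₃CoPH F N θ hP).C.toB12 γ₀ b b')
    (hx : ∀ (F : T4Family) (θ : Stage13HParams F N) (hP : θ.Provisos₁₃CoPH F N), G θ → θ.Admissible F N →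
      B16.EndStatementBPrinted (datumOfRecord₁₃CoPH F N θ hP).C → DagBinding.EndpointExistence (datumOfRecord₁₃CoPH F N θ hP).C.toB12 →
        ForSmallCouplings (datumOfRecord₁₃CoPH F N θ hP) fun g₀ => ∀ os : List (ULoop F),
          0 < (cr F θ hP g₀ os).l₀ ∧ 0 < (cr F θ hP g₀ os).vol ∧
          (∀ (K : ℕ) (t : ℝ), |t| ≤ (cr F θ hP g₀ os).l₀ →
            T4GenFunBounds.schemeZ ((datumOfRecord₁₃CoPH F N θ hP).scheme g₀) os ((cr F θ hP g₀ os).K₀ + K) t =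
              ∑ τ ∈ (cr F θ hP g₀ os).T K, (cr F θ hP g₀ os).A K t τ) ∧
          (∀ (K : ℕ) (t : ℝ), |t| ≤ (cr F θ hP g₀ os).l₀ →
            T4GenFunBounds.schemeZ ((datumOfRecord₁₃CoPH F N θ hP).scheme g₀) os ((cr F θ hP g₀ os).K₀ + K + 1) t =
              ∑ τ ∈ (cr F θ hP g₀ os).T K, (cr F θ hP g₀ os).B K t τ))
    (F : T4Family) (θ : Stage13HParams F N) (hP : θ.Provisos₁₃CoPH F N) (hG : G θ) (hθ : θ.Admissible F N) :
    HybridNE7Under (datumOfRecord₁₃CoPH F N θ hP) (DagBinding.EndpointExistence (datumOfRecord₁₃CoPH F N θ hP).C.toB12) := by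
  refine keyedGuarded₁₃CoPH_of_keyedFacesP_fsc_forallRates cr (fun F θ hP g₀ os => rateCarriersOfRecord₁₃CoPH 𝔯 F θ hP g₀ os (ks F θ hP g₀ os)) G
    (fun D R => RatesHolderAt D R β ∧ ReadOutAt D R.u3 ∧ (0 ≤ R.u3.ρ ∧ R.u3.ρ < 1)) h20 h21 hrates (fun F θ hP hG hθ _ _ => ?_) hx F θ hP hG hθ
  obtain ⟨γ₀, b, b', hγ₀, hβ⟩ := hβw F θ hP hG hθ
  exact h19w F θ hP hG hθ hγ₀ hβ


/-- **… THE SAME WITH A POSITIVE LOWER WINDOW CONSTANT** (`0 < b` threaded: the `h19w` shape of this seat's AtRunsAlong face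
`N19RateEdgeHolderD4AtRunsAlong.forSmallCouplings_keyedCoreEdgeHolderD4_of_linkReadingAtRunsAlong`, which reads BOTH halves of K1⁷'s window). [bookkeeping] -/
theorem keyedGuarded₁₃CoPH_of_fscCoreEdgeHolderD4_betaWindowPos (𝔯 : RateReading₁₃CoPH N) {β : ℝ}
    (ks : (F : T4Family) → (θ : Stage13HParams F N) → θ.Provisos₁₃CoPH F N → (ℕ → ℝ) → List (ULoop F) → ℕ)
    (h20 : ∀ (F : T4Family) (θ : Stage13HParams F N) (hP : θ.Provisos₁₃CoPH F N), G θ → θ.Admissible F N → ∀ (g₀ : ℕ → ℝ) (os : List (ULoop F)),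
      RelWeightBound (cr F θ hP g₀ os).l₀ (cr F θ hP g₀ os).T (cr F θ hP g₀ os).A (cr F θ hP g₀ os).B (cr F θ hP g₀ os).Bad (cr F θ hP g₀ os).W)
    (h21 : ∀ (F : T4Family) (θ : Stage13HParams F N) (hP : θ.Provisos₁₃CoPH F N), G θ → θ.Admissible F N → ∀ (g₀ : ℕ → ℝ) (os : List (ULoop F)),
      ShellWeightBound (cr F θ hP g₀ os).l₀ (cr F θ hP g₀ os).T (cr F θ hP g₀ os).A (cr F θ hP g₀ os).B (cr F θ hP g₀ os).shA (cr F θ hP g₀ os).shB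
        (cr F θ hP g₀ os).Wsh)
    (hrates : ∀ (F : T4Family) (θ : Stage13HParams F N) (hP : θ.Provisos₁₃CoPH F N), G θ → θ.Admissible F N → ∀ (g₀ : ℕ → ℝ) (os : List (ULoop F)),
      RatesHolderAt (datumOfRecord₁₃CoPH F N θ hP) (rateCarriersOfRecord₁₃CoPH 𝔯 F θ hP g₀ os (ks F θ hP g₀ os)) β ∧
        ReadOutAt (datumOfRecord₁₃CoPH F N θ hP) (rateCarriersOfRecord₁₃CoPH 𝔯 F θ hP g₀ os (ks F θ hP g₀ os)).u3 ∧
        (0 ≤ (rateCarriersOfRecord₁₃CoPH 𝔯 F θ hP g₀ os (ks F θ hP g₀ os)).u3.ρ ∧ (rateCarriersOfRecord₁₃CoPH 𝔯 F θ hP g₀ os (ks F θ hP g₀ os)).u3.ρ < 1))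
    (h19w : ∀ (F : T4Family) (θ : Stage13HParams F N) (hP : θ.Provisos₁₃CoPH F N), G θ → θ.Admissible F N → ∀ {γ₀ b b' : ℝ}, 0 < γ₀ → 0 < b →
      DagBinding.BetaBoundsInInterval (datumOfRecord₁₃CoPH F N θ hP).C.toB12 γ₀ b b' →
        ForSmallCouplings (datumOfRecord₁₃CoPH F N θ hP) fun g₀ => ∀ os : List (ULoop F),
          (RatesHolderAt (datumOfRecord₁₃CoPH F N θ hP) (rateCarriersOfRecord₁₃CoPH 𝔯 F θ hP g₀ os (ks F θ hP g₀ os)) β ∧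
            ReadOutAt (datumOfRecord₁₃CoPH F N θ hP) (rateCarriersOfRecord₁₃CoPH 𝔯 F θ hP g₀ os (ks F θ hP g₀ os)).u3 ∧
            (0 ≤ (rateCarriersOfRecord₁₃CoPH 𝔯 F θ hP g₀ os (ks F θ hP g₀ os)).u3.ρ ∧
              (rateCarriersOfRecord₁₃CoPH 𝔯 F θ hP g₀ os (ks F θ hP g₀ os)).u3.ρ < 1)) →
          letI := (cr F θ hP g₀ os).dec
          ∃ δ : ℕ → ℝ, NE7.Core (cr F θ hP g₀ os).l₀ (cr F θ hP g₀ os).vol (cr F θ hP g₀ os).T (cr F θ hP g₀ os).Bad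
            (fun K t τ => (cr F θ hP g₀ os).A K t τ - (cr F θ hP g₀ os).shA K t τ) (fun K t τ => (cr F θ hP g₀ os).B K t τ - (cr F θ hP g₀ os).shB K t τ) δ ∧
            Summable δ)
    (hβw : ∀ (F : T4Family) (θ : Stage13HParams F N) (hP : θ.Provisos₁₃CoPH F N), G θ → θ.Admissible F N →
      ∃ γ₀ b b' : ℝ, 0 < γ₀ ∧ 0 < b ∧ DagBinding.BetaBoundsInInterval (datumOfRecord₁₃CoPH F N θ hP).C.toB12 γ₀ b b')
    (hx : ∀ (F : T4Family) (θ : Stage13HParams F N) (hP : θ.Provisos₁₃CoPH F N), G θ → θ.Admissible F N →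
      B16.EndStatementBPrinted (datumOfRecord₁₃CoPH F N θ hP).C → DagBinding.EndpointExistence (datumOfRecord₁₃CoPH F N θ hP).C.toB12 →
        ForSmallCouplings (datumOfRecord₁₃CoPH F N θ hP) fun g₀ => ∀ os : List (ULoop F),
          0 < (cr F θ hP g₀ os).l₀ ∧ 0 < (cr F θ hP g₀ os).vol ∧
          (∀ (K : ℕ) (t : ℝ), |t| ≤ (cr F θ hP g₀ os).l₀ →
            T4GenFunBounds.schemeZ ((datumOfRecord₁₃CoPH F N θ hP).scheme g₀) os ((cr F θ hP g₀ os).K₀ + K) t =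
              ∑ τ ∈ (cr F θ hP g₀ os).T K, (cr F θ hP g₀ os).A K t τ) ∧
          (∀ (K : ℕ) (t : ℝ), |t| ≤ (cr F θ hP g₀ os).l₀ →
            T4GenFunBounds.schemeZ ((datumOfRecord₁₃CoPH F N θ hP).scheme g₀) os ((cr F θ hP g₀ os).K₀ + K + 1) t =
              ∑ τ ∈ (cr F θ hP g₀ os).T K, (cr F θ hP g₀ os).B K t τ))
    (F : T4Family) (θ : Stage13HParams F N) (hP : θ.Provisos₁₃CoPH F N) (hG : G θ) (hθ : θ.Admissible F N) :
    HybridNE7Under (datumOfRecord₁₃CoPH F N θ hP) (DagBinding.EndpointExistence (datumOfRecord₁₃CoPH F N θ hP).C.toB12) := by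
  refine keyedGuarded₁₃CoPH_of_keyedFacesP_fsc_forallRates cr (fun F θ hP g₀ os => rateCarriersOfRecord₁₃CoPH 𝔯 F θ hP g₀ os (ks F θ hP g₀ os)) G
    (fun D R => RatesHolderAt D R β ∧ ReadOutAt D R.u3 ∧ (0 ≤ R.u3.ρ ∧ R.u3.ρ < 1)) h20 h21 hrates (fun F θ hP hG hθ _ _ => ?_) hx F θ hP hG hθ
  obtain ⟨γ₀, b, b', hγ₀, hb0, hβ⟩ := hβw F θ hP hG hθ
  exact h19w F θ hP hG hθ hγ₀ hb0 hβ

end Stage13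

end Summit.QuantumFields.YangMills.BalabanUVNodes.N19CoreEdgeFSCComposer

end
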